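import Mathlib

/-!
# `stub_integrateStateDensity` of LINE «toron-valley volume» (planner ym-idea-4 g15, route `ToronValleyVolume`, crux
# ⟨stmt-QuantumFields-24497⟩ `ToronTubeVolumeLaw`): a state-density power-log law integrates to the cumulative law

Free-hands work of the LEAD seat ym-line-sfw-p2 (gen 74).  The registered skeleton
`ideators/ym-idea-4/bc/g15-B/ToronTubeVolumeLaw_birth.lean` cuts the crux into the HEART `stub_stateDensityLaw` and the
pure real-analysis stub proved here (Props `CumulativeLaw`, `StateDensityLaw`, `IntegrateStateDensity` restated
CHARACTER-IDENTICALLY, same namespace, so the stub closes BY NAME):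

  if `m(t) = ∫_{(0,t]} f`, `f = g·(1 + r)` with `|r(s)| ≤ κ s^θ` and `g(s) = v s^{λ−1}(λ(e log s⁻¹ + c) − e)`
  (`λ ≥ 1`, `e ≥ 0`, `4e ≤ λℓ₀`, `e log s⁻¹ + c ≥ ℓ₀ > 0` on `(0,t₀]`), then
  `|m(t)/(v t^λ (e log t⁻¹ + c)) − 1| ≤ 4κ t^θ` on `(0, t₀]`.

Proof: `g = G'` for `G(s) = v s^λ (e log s⁻¹ + c)`, `G(0⁺) = 0` (`λ ≥ 1`, `s^λ log s → 0`), `g > 0` on `(0,t₀]`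
(`λℓ₀ ≥ 4e`), so `∫_{(0,t]} g = G(t)` (FTC with a one-sided singular endpoint, `g ∈ L¹` because `log ∈ L¹[0,t]`);
pointwise `|f − g| ≤ κ s^θ g ≤ κ t^θ g`, hence `|m(t) − G(t)| ≤ κ t^θ G(t)` — the stub's `4κ` has a factor-4 margin.

HONEST LABEL: a support stub (pure real analysis) of a DRAFT-by-design sub-route; the heart `ToronStateDensityLaw`
is untouched; no crux, rung, leaf or summit is proved; the Yang–Mills mass gap is NOT proved by this.
-/

noncomputable section

namespace Summit.QuantumFields.YangMills.Cruxes.ToronTubeVolumeLaw.Birth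

open MeasureTheory Set Filter Real
open scoped Topology

/-! ## §0 The Props of the registered skeleton (character-identical) -/

/-- Abstract cumulative power-log law for a volume function `m` on `(0, t₀]` (shape of the crux, real-variable form). -/
def CumulativeLaw (m : ℝ → ℝ) (lam v e c κ θ t₀ ℓ₀ : ℝ) : Prop :=
  ∀ t : ℝ, 0 < t → t ≤ t₀ → ℓ₀ ≤ e * Real.log t⁻¹ + c ∧ |m t / (v * t ^ lam * (e * Real.log t⁻¹ + c)) - 1| ≤ κ * t ^ θ

/-- Abstract state-density power-log law: `m(t) = ∫_{(0,t]} f` with `f(s) = v s^{λ−1}(λ(e log s⁻¹ + c) − e)(1 + r(s))`, `|r(s)| ≤ κ s^θ`. -/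
def StateDensityLaw (m : ℝ → ℝ) (lam v e c κ θ t₀ ℓ₀ : ℝ) : Prop :=
  ∃ f : ℝ → ℝ, Measurable f ∧ (∀ s, 0 ≤ f s) ∧
    (∀ t : ℝ, 0 < t → t ≤ t₀ → m t = ∫ s in Set.Ioc 0 t, f s) ∧
    ∀ s : ℝ, 0 < s → s ≤ t₀ →
      ℓ₀ ≤ e * Real.log s⁻¹ + c ∧
      |f s / (v * s ^ (lam - 1) * (lam * (e * Real.log s⁻¹ + c) - e)) - 1| ≤ κ * s ^ θ

/-- Statement of `stub_integrateStateDensity` (pure real analysis): a state-density law integrates to the cumulative law with error `4κ`,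
under side conditions that the ring instance meets (`λ ≥ 1`, `κ t₀^θ ≤ 1/2`, `4e ≤ λ ℓ₀`). -/
def IntegrateStateDensity : Prop :=
  ∀ (m : ℝ → ℝ) (lam v e c κ θ t₀ ℓ₀ : ℝ), 1 ≤ lam → 0 < v → 0 ≤ e → 0 ≤ κ → 0 < θ → θ ≤ 1 → 0 < t₀ → 0 < ℓ₀ →
    κ * t₀ ^ θ ≤ 1 / 2 → 4 * e ≤ lam * ℓ₀ →
    StateDensityLaw m lam v e c κ θ t₀ ℓ₀ → CumulativeLaw m lam v e c (4 * κ) θ t₀ ℓ₀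

/-! ## §1 The model density `g = G'` and its primitive `G` -/

/-- `G(s) = v·s^λ·(e·log s⁻¹ + c)` has derivative `g(s) = v·s^{λ−1}·(λ(e·log s⁻¹ + c) − e)` at every `s > 0`. -/
theorem hasDerivAt_primitive (lam v e c : ℝ) {s : ℝ} (hs : 0 < s) :
    HasDerivAt (fun s : ℝ => v * s ^ lam * (e * Real.log s⁻¹ + c))
      (v * s ^ (lam - 1) * (lam * (e * Real.log s⁻¹ + c) - e)) s := by
  have h1 : HasDerivAt (fun s : ℝ => s ^ lam) (lam * s ^ (lam - 1)) s :=
    Real.hasDerivAt_rpow_const (Or.inl hs.ne')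
  have h2 : HasDerivAt (fun s : ℝ => e * Real.log s⁻¹ + c) (e * (-s⁻¹)) s := by
    have hl : HasDerivAt (fun s : ℝ => Real.log s⁻¹) (-s⁻¹) s := by
      have := (Real.hasDerivAt_log hs.ne').neg
      refine this.congr_of_eventuallyEq ?_
      filter_upwards [lt_mem_nhds hs] with x hx
      simp [Real.log_inv]
    simpa using (hl.const_mul e).add_const c
  have h12 : HasDerivAt (fun s : ℝ => s ^ lam * (e * Real.log s⁻¹ + c))
      (lam * s ^ (lam - 1) * (e * Real.log s⁻¹ + c) + s ^ lam * (e * (-s⁻¹))) s := h1.mul h2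
  have h3 := h12.const_mul v
  have h4 : (fun s : ℝ => v * s ^ lam * (e * Real.log s⁻¹ + c)) =
      fun s => v * (s ^ lam * (e * Real.log s⁻¹ + c)) := by
    funext x; ring
  rw [h4]
  refine h3.congr_deriv ?_
  have hs' : s ^ lam = s ^ (lam - 1) * s := by
    rw [← Real.rpow_add_one hs.ne' (lam - 1)]; ring_nf
  rw [hs']
  field_simp
  ring

/-- `G` is continuous on `[0, t]` (value `0` at `0`: `s^λ log s → 0` since `λ ≥ 1 > 0`; Mathlib's `log 0 = 0`, `0⁻¹ = 0`). -/
theorem continuousOn_primitive (lam v e c : ℝ) (hlam : 1 ≤ lam) (t : ℝ) :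
    ContinuousOn (fun s : ℝ => v * s ^ lam * (e * Real.log s⁻¹ + c)) (Icc 0 t) := by
  have hlam0 : 0 < lam := by linarith
  intro s hs
  rcases eq_or_lt_of_le hs.1 with h0 | hpos
  · -- the endpoint `s = 0`: one-sided limit
    subst h0
    have h1 : Tendsto (fun s : ℝ => Real.log s * s ^ lam) (𝓝[>] 0) (𝓝 0) :=
      tendsto_log_mul_rpow_nhdsGT_zero hlam0
    have h2 : Tendsto (fun s : ℝ => s ^ lam) (𝓝[>] 0) (𝓝 0) := by
      have := (Real.continuousAt_rpow_const 0 lam (Or.inr hlam0.le)).tendsto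
      rw [Real.zero_rpow hlam0.ne'] at this
      exact this.mono_left nhdsWithin_le_nhds
    have h3 : Tendsto (fun s : ℝ => v * s ^ lam * (e * Real.log s⁻¹ + c)) (𝓝[>] 0) (𝓝 0) := by
      have e1 : ∀ s : ℝ, v * s ^ lam * (e * Real.log s⁻¹ + c) =
          v * (-(e * (Real.log s * s ^ lam)) + c * s ^ lam) := by
        intro s; rw [Real.log_inv]; ring
      simp_rw [e1]
      have := ((h1.const_mul e).neg.add (h2.const_mul c)).const_mul v
      simpa using this
    have h4 : ContinuousWithinAt (fun s : ℝ => v * s ^ lam * (e * Real.log s⁻¹ + c)) (Ioi 0) 0 := by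
      rw [ContinuousWithinAt]
      simpa [Real.zero_rpow hlam0.ne'] using h3
    exact (continuousWithinAt_Ioi_iff_Ici.mp h4).mono Icc_subset_Ici_self
  · exact ContinuousAt.continuousWithinAt (by
      have h1 : ContinuousAt (fun s : ℝ => s ^ lam) s := Real.continuousAt_rpow_const _ _ (Or.inl hpos.ne')
      have h2 : ContinuousAt (fun s : ℝ => Real.log s⁻¹) s :=
        (Real.continuousAt_log (inv_ne_zero hpos.ne')).comp (continuousAt_inv₀ hpos.ne')
      exact (continuousAt_const.mul h1).mul ((continuousAt_const.mul h2).add continuousAt_const))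

/-- The model density `g` is integrable on `[0, t]` (`λ ≥ 1`: `s^{λ−1}` continuous on `[0,t]`, `log ∈ L¹[0,t]`). -/
theorem intervalIntegrable_density (lam v e c : ℝ) (hlam : 1 ≤ lam) (t : ℝ) :
    IntervalIntegrable (fun s : ℝ => v * s ^ (lam - 1) * (lam * (e * Real.log s⁻¹ + c) - e)) volume 0 t := by
  have hlog : IntervalIntegrable (fun s : ℝ => Real.log s⁻¹) volume 0 t := by
    have e1 : (fun s : ℝ => Real.log s⁻¹) = fun s => -Real.log s := by
      funext s; exact Real.log_inv s
    rw [e1]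
    exact intervalIntegral.intervalIntegrable_log'.neg
  have h1 : IntervalIntegrable (fun s : ℝ => e * Real.log s⁻¹ + c) volume 0 t :=
    (hlog.const_mul e).add intervalIntegrable_const
  have h2 : IntervalIntegrable (fun s : ℝ => lam * (e * Real.log s⁻¹ + c) - e) volume 0 t :=
    (h1.const_mul lam).sub intervalIntegrable_const
  have hg : ContinuousOn (fun s : ℝ => v * s ^ (lam - 1)) (uIcc 0 t) :=
    (continuous_const.mul (Real.continuous_rpow_const (by linarith : 0 ≤ lam - 1))).continuousOn
  exact h2.continuousOn_mul hg

/-! ## §2 The stub -/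

/-- ★ **Registered stub `stub_integrateStateDensity` BY NAME** (skeleton `bc/g15-B/ToronTubeVolumeLaw_birth.lean` of planner
ym-idea-4 g15 on crux ⟨stmt-QuantumFields-24497⟩): a state-density power-log law integrates to the cumulative law, with
relative error `4κ t^θ` (in fact `κ t^θ`). -/
theorem stub_integrateStateDensity : IntegrateStateDensity := by
  intro m lam v e c κ θ t₀ ℓ₀ hlam hv he hκ hθ _hθ1 ht₀ hℓ₀ _hκt₀ h4e hSD
  obtain ⟨f, hfm, hf0, hm, hf⟩ := hSD
  intro t ht htt₀
  refine ⟨(hf t ht htt₀).1, ?_⟩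
  have hlam0 : 0 < lam := by linarith
  -- `g > 0` on `(0, t₀]` (`λℓ₀ ≥ 4e ≥ e`)
  have hgpos : ∀ s, 0 < s → s ≤ t₀ → 0 < v * s ^ (lam - 1) * (lam * (e * Real.log s⁻¹ + c) - e) := by
    intro s hs hst
    have h1 := (hf s hs hst).1
    have h2 : 0 < lam * (e * Real.log s⁻¹ + c) - e := by
      nlinarith [mul_le_mul_of_nonneg_left h1 hlam0.le, mul_pos hlam0 hℓ₀]
    have h3 : 0 < s ^ (lam - 1) := Real.rpow_pos_of_pos hs _
    positivity
  -- pointwise: `|f − g| ≤ κ t^θ g` on `(0, t]`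
  have hpt : ∀ s ∈ Ioc (0:ℝ) t, |f s - v * s ^ (lam - 1) * (lam * (e * Real.log s⁻¹ + c) - e)| ≤
      κ * t ^ θ * (v * s ^ (lam - 1) * (lam * (e * Real.log s⁻¹ + c) - e)) := by
    intro s hs
    have hst₀ : s ≤ t₀ := hs.2.trans htt₀
    have hg := hgpos s hs.1 hst₀
    have h := (hf s hs.1 hst₀).2
    rw [div_sub_one hg.ne', abs_div, abs_of_pos hg, div_le_iff₀ hg] at h
    have hsθ : s ^ θ ≤ t ^ θ := Real.rpow_le_rpow hs.1.le hs.2 hθ.le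
    exact h.trans (mul_le_mul_of_nonneg_right (mul_le_mul_of_nonneg_left hsθ hκ) hg.le)
  -- integrability of `g` and `f` on `(0, t]`
  have hgi : IntervalIntegrable (fun s : ℝ => v * s ^ (lam - 1) * (lam * (e * Real.log s⁻¹ + c) - e)) volume 0 t :=
    intervalIntegrable_density lam v e c hlam t
  have hgi' : IntegrableOn (fun s : ℝ => v * s ^ (lam - 1) * (lam * (e * Real.log s⁻¹ + c) - e)) (Ioc 0 t) :=
    (intervalIntegrable_iff_integrableOn_Ioc_of_le ht.le).1 hgi
  have hfi : IntegrableOn f (Ioc 0 t) := by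
    refine Integrable.mono' (hgi'.const_mul (1 + κ * t ^ θ)) hfm.aestronglyMeasurable ?_
    refine (ae_restrict_iff' measurableSet_Ioc).2 (Eventually.of_forall fun s hs => ?_)
    rw [Real.norm_eq_abs, abs_of_nonneg (hf0 s)]
    have h1 := hpt s hs
    have hg := (hgpos s hs.1 (hs.2.trans htt₀)).le
    rw [abs_sub_le_iff] at h1
    nlinarith [h1.1]
  -- `∫_{(0,t]} g = G(t)` (FTC with the singular endpoint `0`)
  have hG : ∫ s in Ioc 0 t, v * s ^ (lam - 1) * (lam * (e * Real.log s⁻¹ + c) - e) =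
      v * t ^ lam * (e * Real.log t⁻¹ + c) := by
    rw [← intervalIntegral.integral_of_le ht.le,
      intervalIntegral.integral_eq_sub_of_hasDerivAt_of_le ht.le (continuousOn_primitive lam v e c hlam t)
        (fun s hs => hasDerivAt_primitive lam v e c hs.1) hgi]
    simp [Real.zero_rpow hlam0.ne']
  -- `G(t) > 0` and `|m(t) − G(t)| ≤ κ t^θ G(t)`
  have hGpos : 0 < v * t ^ lam * (e * Real.log t⁻¹ + c) := by
    have h1 := (hf t ht htt₀).1
    have h2 : 0 < e * Real.log t⁻¹ + c := lt_of_lt_of_le hℓ₀ h1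
    have h3 : 0 < t ^ lam := Real.rpow_pos_of_pos ht _
    positivity
  have hdiff : |m t - v * t ^ lam * (e * Real.log t⁻¹ + c)| ≤
      κ * t ^ θ * (v * t ^ lam * (e * Real.log t⁻¹ + c)) := by
    rw [hm t ht htt₀, ← hG, ← integral_sub hfi hgi']
    calc |∫ s in Ioc 0 t, (f s - v * s ^ (lam - 1) * (lam * (e * Real.log s⁻¹ + c) - e))|
        ≤ ∫ s in Ioc 0 t, |f s - v * s ^ (lam - 1) * (lam * (e * Real.log s⁻¹ + c) - e)| :=
          abs_integral_le_integral_abs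
      _ ≤ ∫ s in Ioc 0 t, κ * t ^ θ * (v * s ^ (lam - 1) * (lam * (e * Real.log s⁻¹ + c) - e)) :=
          setIntegral_mono_on (hfi.sub hgi').abs (hgi'.const_mul _) measurableSet_Ioc hpt
      _ = κ * t ^ θ * ∫ s in Ioc 0 t, v * s ^ (lam - 1) * (lam * (e * Real.log s⁻¹ + c) - e) :=
          integral_const_mul _ _
  -- conclude: `|m/G − 1| = |m − G|/G ≤ κ t^θ ≤ 4κ t^θ`
  rw [div_sub_one hGpos.ne', abs_div, abs_of_pos hGpos, div_le_iff₀ hGpos]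
  have ht4 : κ * t ^ θ * (v * t ^ lam * (e * Real.log t⁻¹ + c)) ≤
      4 * κ * t ^ θ * (v * t ^ lam * (e * Real.log t⁻¹ + c)) := by
    have : 0 ≤ κ * t ^ θ := mul_nonneg hκ (Real.rpow_nonneg ht.le _)
    nlinarith [hGpos.le]
  exact hdiff.trans ht4

end Summit.QuantumFields.YangMills.Cruxes.ToronTubeVolumeLaw.Birth

end
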